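import Summits.BirchSwinnertonDyer.BirchSwinnertonDyer.Theorems.ThetaPartnerAtTwoSignedControlAtTwoLocalNonDivTwo
import Literature.NumberTheory.EllipticCurves.ComplexMultiplication
import Literature.NumberTheory.EllipticCurves.AnalyticRank
import HarnessLib

/-!
# Route `ThetaPartnerAtTwo` (TP2), crux K2r0 `SignedMainConjectureCMTwoRankZero` (stmt-BirchSwinnertonDyer-20312),
# line `rankzero` v9 (sha16 004af765e6d29cc6): registered stub `stub_localNonDivCMTwo` (LEV0@2 read for the CM row) PROVED

HONEST FRAMING (cell `pub/bsd-wall`, lead prover `bsd-wall-tp2-p2` g4): one registered stub of the line skeleton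
`Cruxes/SignedMainConjectureCMTwoRankZero/Lines/rankzero.lean` proved VERBATIM, as the K2r0 copy of K4's LEV0@2: at the place
`v ∋ 2` some point of `E(ℚ_v)` is not `2`-divisible in `E(ℚ_v)` — for EVERY elliptic `W/ℚ`, by seat tp2-p3-w3's landed
`SignedEC.exists_mem_localLayerPointsOfEmb_zero_ne_two_nsmul` (p585289: Milne ADT I Lemma 3.3, `#E(ℚ_v)/2E(ℚ_v) = 2·#E(ℚ_v)[2]`).
The CM / rank / reduction binders of the stub are not used. Closes nothing by itself (the line's load-bearing stub is
(MC±2^k)_A); BSD is not proved by any of this.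

References: [MilneADT2006] I Lemma 3.3; [SilvermanAEC2009] Prop. VII.6.3; line card `Cruxes/SignedMainConjectureCMTwoRankZero/Lines/rankzero.md`.
-/

set_option autoImplicit false
-- the Theorems namespace of this sub repeats the summit name by design (D-0017 nested layout)
set_option linter.dupNamespace false

noncomputable section

open scoped NumberField

open NumberField IsDedekindDomain WeierstrassCurve Literature.NumberTheory.EllipticCurves
  Literature.NumberTheory.GaloisRepresentations Literature.NumberTheory.EllipticCurves.Rank1Residual
  Literature.NumberTheory.EllipticCurves.Kobayashi2003 ZpExtension

namespace Summit.BirchSwinnertonDyer.BirchSwinnertonDyer.Cruxes.SignedMainConjectureCMTwoRankZero.RankZero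

/-- **Stub `stub_localNonDivCMTwo` of line `rankzero` (registered signature, verbatim): LEV0@2 for the CM row.** For every
CM curve `A/ℚ` (globally minimal) of analytic rank `0`, good supersingular at `2` with `a₂ = 0`, every cyclotomic `ℤ₂`-extension
`κ` and the place `v ∋ 2`: some point of `E(ℚ_v)` (the layer-`0` points) is not `2`-divisible in `E(ℚ_v)`. True for every
elliptic curve over `ℚ` (`SignedEC.exists_mem_localLayerPointsOfEmb_zero_ne_two_nsmul`, seat tp2-p3-w3, p585289); the row's
binders are idle. [cite: MilneADT2006, I Lemma 3.3] [cite: SilvermanAEC2009, Prop. VII.6.3] -/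
theorem stub_localNonDivCMTwo :
    ∀ (A : WeierstrassCurve ℚ) [A.IsElliptic] [A.IsGloballyMinimal],
      A.HasCM → A.analyticRank = 0 → GoodSS A 2 → A.frobeniusTrace 2 = 0 →
      ∀ (κ : ZpExtension ℚ 2), κ.IsCyclotomic →
      ∀ (v : HeightOneSpectrum (𝓞 ℚ)), (2 : 𝓞 ℚ) ∈ v.asIdeal →
      ∃ m₀ ∈ localLayerPointsOfEmb κ (closureEmb (K := ℚ) (v.adicCompletion ℚ)) A 0,
        ∀ b ∈ localLayerPointsOfEmb κ (closureEmb (K := ℚ) (v.adicCompletion ℚ)) A 0, m₀ ≠ 2 • b :=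
  fun A _ _ _ _ _ _ κ _ v hv ↦
    Summit.BirchSwinnertonDyer.BirchSwinnertonDyer.Theorems.SignedEC.exists_mem_localLayerPointsOfEmb_zero_ne_two_nsmul A κ v hv

end Summit.BirchSwinnertonDyer.BirchSwinnertonDyer.Cruxes.SignedMainConjectureCMTwoRankZero.RankZero

end
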